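import Literature.AlgebraicTopology.CharacteristicClasses.LineEulerClass
import HarnessLib

/-!
# Naturality of the Thom and Euler classes of line bundles under arbitrary bundle maps

D. Husemoller, *Fibre Bundles* (3rd ed. 1994), Ch. 17 §3 Prop. 3.3 ((C₁): `c(f^*ξ) = f^*c(ξ)` and
invariance under isomorphism) in the form covering BOTH at once: a map of complex line bundles
`Ψ : λ₁ → λ₂` over `g : B₁ → B₂` which is a linear ISOMORPHISM on each fibre (`φ_b : λ₁,b ≅ λ₂,g b`,
continuous total map) — e.g. the inclusion of the restriction of `λ₂` to a subspace, the canonical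
map `λ₁ = g^*λ₂ → λ₂`, an isomorphism over `B`, or the tautological map `γ¹(W) → γ¹(V)` over
`ℙ(W) → ℙ(V)` of a linear injection. Then, over paracompact Hausdorff bases,

* `thomClass_bundleMap`: `P(Ψ)^* t(λ₂) = t(λ₁)` (`P(Ψ) : P(λ₁ ⊕ ℂ) → P(λ₂ ⊕ ℂ)` the induced map of
  projective completions, `ProjectiveCompletionMap.complMapC`): `P(Ψ)^* t(λ₂)` is a Thom class of
  `λ₁` (`isThomClass_map_lineComplMap`: compatible with the sections at infinity and the fibres, the
  fibre generators being choice-free, `map_projProd_omegaStd`), and Thom classes are unique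
  (`LineThomClassUniqueness`);
* `eulerClass_bundleMap`: **`e(λ₁) = g^* e(λ₂)`**.

(`LineEulerClass` has the two special cases `g^*λ → λ` and `B₁ = B₂`, `g = 𝟙`.) Everything is
proved; no named facts.

## References

* D. Husemoller, *Fibre Bundles*, GTM 20, Springer 1994, Ch. 17 §3 Prop. 3.3. [HusemollerFibreBundles1994]
* J. Milnor, J. Stasheff, *Characteristic Classes*, PUP 1974, §9 (naturality of the Thom class), §14 Lemma 14.2. [MilnorStasheff1974]
-/

noncomputable section

open CategoryTheory Function Set Bundle Literature.AlgebraicTopology.SingularHomology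
open scoped LinearAlgebra.Projectivization

universe u

namespace Literature.AlgebraicTopology.CharacteristicClasses

variable {B₁ B₂ : Type u} [TopologicalSpace B₁] [TopologicalSpace B₂]
  (F₁ : Type u) [NormedAddCommGroup F₁] [NormedSpace ℂ F₁] [FiniteDimensional ℂ F₁]
  (F₂ : Type u) [NormedAddCommGroup F₂] [NormedSpace ℂ F₂] [FiniteDimensional ℂ F₂]
  (E₁ : B₁ → Type u) [∀ b, AddCommGroup (E₁ b)] [∀ b, Module ℂ (E₁ b)]
  [TopologicalSpace (TotalSpace F₁ E₁)] [∀ b, TopologicalSpace (E₁ b)] [FiberBundle F₁ E₁] [VectorBundle ℂ F₁ E₁]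
  (E₂ : B₂ → Type u) [∀ b, AddCommGroup (E₂ b)] [∀ b, Module ℂ (E₂ b)]
  [TopologicalSpace (TotalSpace F₂ E₂)] [∀ b, TopologicalSpace (E₂ b)] [FiberBundle F₂ E₂] [VectorBundle ℂ F₂ E₂]
  (hF₁ : Module.finrank ℂ F₁ = 1) (hF₂ : Module.finrank ℂ F₂ = 1) (R : Type u) [CommRing R]
  {g : C(B₁, B₂)} (φ : ∀ b, E₁ b ≃L[ℂ] E₂ (g b))
  (hΨ : Continuous fun q : TotalSpace F₁ E₁ ↦ (⟨g q.proj, φ q.proj q.2⟩ : TotalSpace F₂ E₂))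

/-- **The map `P(Ψ) : P(λ₁ ⊕ ℂ) → P(λ₂ ⊕ ℂ)` of projective completions** induced by a fibrewise
isomorphic bundle map `Ψ` over `g`. [cite: HusemollerFibreBundles1994, Ch. 17 §2] -/
def lineComplMap : C(ProjCompl F₁ E₁, ProjCompl F₂ E₂) :=
  complMapC (F₁ := F₁) (F₂ := F₂) (E₁ := E₁) (E₂ := E₂) (g := g)
    (fun b ↦ ((φ b : E₁ b →L[ℂ] E₂ (g b)) : E₁ b →ₗ[ℂ] E₂ (g b))) (fun b ↦ (φ b).injective) hΨ

omit [FiniteDimensional ℂ F₁] [FiniteDimensional ℂ F₂] in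
/-- **`ℙ(φ_b × 𝟙)^* ω_{g b} = ω_b`**: the fibre generators are choice-free (`map_projProd_omegaStd`). [folklore] -/
theorem map_projProd₂_omegaFib_base (b : B₁) (m : R) :
    singularCohomology.map R R (projProd₂ (φ b)) 2 (omegaFib F₂ E₂ hF₂ R R (g b) m) = omegaFib F₁ E₁ hF₁ R R b m := by
  rw [omegaFib, ← ModuleCat.comp_apply, ← singularCohomology.map_comp, ← projProd_trans]
  exact map_projProd_omegaStd F₁ E₁ hF₁ R R b _ m

/-- **`P(Ψ)` pulls Thom classes back to Thom classes.** [cite: MilnorStasheff1974, §9 (naturality of the Thom class)] -/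
theorem isThomClass_map_lineComplMap {m : R} {t : singularCohomology R R (ProjCompl F₂ E₂) 2}
    (ht : IsThomClass F₂ E₂ hF₂ R m t) :
    IsThomClass F₁ E₁ hF₁ R m (singularCohomology.map R R (lineComplMap F₁ F₂ E₁ E₂ φ hΨ) 2 t) where
  map_complInf := by
    have hc : (lineComplMap F₁ F₂ E₁ E₂ φ hΨ).comp (complInf F₁ E₁ hF₁) = (complInf F₂ E₂ hF₂).comp g :=
      ContinuousMap.ext fun b ↦ complMap_complInf (F₁ := F₁) (F₂ := F₂) (E₁ := E₁) (E₂ := E₂) (g := g)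
        (fun b ↦ ((φ b : E₁ b →L[ℂ] E₂ (g b)) : E₁ b →ₗ[ℂ] E₂ (g b))) (fun b ↦ (φ b).injective) hF₁ hF₂ b
    rw [← ModuleCat.comp_apply, ← singularCohomology.map_comp, hc, singularCohomology.map_comp, ModuleCat.comp_apply,
      ht.map_complInf, map_zero]
  map_complFibreIncl b := by
    have hc : (lineComplMap F₁ F₂ E₁ E₂ φ hΨ).comp (complFibreIncl F₁ E₁ b) =
        (complFibreIncl F₂ E₂ (g b)).comp (projProd₂ (φ b)) := by
      ext1 ℓ
      change complMap F₁ F₂ E₁ E₂ (g := g) (fun b ↦ ((φ b : E₁ b →L[ℂ] E₂ (g b)) : E₁ b →ₗ[ℂ] E₂ (g b)))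
        (fun b ↦ (φ b).injective) ⟨b, ℓ⟩ = ⟨g b, projProd₂ (φ b) ℓ⟩
      induction ℓ using Projectivization.ind with
      | h v hv => rfl
    rw [← ModuleCat.comp_apply, ← singularCohomology.map_comp, hc, singularCohomology.map_comp, ModuleCat.comp_apply,
      ht.map_complFibreIncl, map_projProd₂_omegaFib_base F₁ F₂ E₁ E₂ hF₁ hF₂ R φ b m]

variable [T2Space B₁] [ParacompactSpace B₁] [T2Space B₂] [ParacompactSpace B₂]

/-- **`P(Ψ)^* t(λ₂) = t(λ₁)`.** [cite: HusemollerFibreBundles1994, Ch. 17 Prop. 3.3] -/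
theorem thomClass_bundleMap (m : R) :
    singularCohomology.map R R (lineComplMap F₁ F₂ E₁ E₂ φ hΨ) 2 (thomClass F₂ E₂ hF₂ R m) = thomClass F₁ E₁ hF₁ R m :=
  (isThomClass_map_lineComplMap F₁ F₂ E₁ E₂ hF₁ hF₂ R φ hΨ (isThomClass_thomClass F₂ E₂ hF₂ R m)).eq_thomClass hF₁

include φ hΨ in
/-- **Naturality of the Euler / first Chern class of line bundles under bundle maps:
`e(λ₁) = g^* e(λ₂)`** for a fibrewise isomorphic bundle map `λ₁ → λ₂` over `g` (Husemoller (C₁)).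
[cite: HusemollerFibreBundles1994, Ch. 17 Prop. 3.3] -/
theorem eulerClass_bundleMap (m : R) :
    eulerClass F₁ E₁ hF₁ R m = singularCohomology.map R R g 2 (eulerClass F₂ E₂ hF₂ R m) := by
  have hc : (lineComplMap F₁ F₂ E₁ E₂ φ hΨ).comp (complZero F₁ E₁) = (complZero F₂ E₂).comp g :=
    ContinuousMap.ext fun b ↦ complMap_complZero (F₁ := F₁) (F₂ := F₂) (E₁ := E₁) (E₂ := E₂) (g := g)
      (fun b ↦ ((φ b : E₁ b →L[ℂ] E₂ (g b)) : E₁ b →ₗ[ℂ] E₂ (g b))) (fun b ↦ (φ b).injective) b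
  rw [eulerClass, eulerClass, ← thomClass_bundleMap F₁ F₂ E₁ E₂ hF₁ hF₂ R φ hΨ m, ← ModuleCat.comp_apply,
    ← singularCohomology.map_comp, hc, singularCohomology.map_comp, ModuleCat.comp_apply]

end Literature.AlgebraicTopology.CharacteristicClasses
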